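import Summits.RiemannHypothesis.RiemannHypothesis.Theses.NymanBeurling
import Literature.NumberTheory.LFunctions.NymanBeurlingDirichlet
import Literature.NumberTheory.LFunctions.LehmanCriticalLineBoundProofs
import Literature.NumberTheory.LFunctions.RHClassicalEquivalentsProofs
import Mathlib.Analysis.SpecialFunctions.JapaneseBracket

/-!
# RiemannHypothesis / NymanBeurling — the distance integral is finite (unconditionally)

Route `RiemannHypothesis/NymanBeurling`, target `NbThesis` (item stmt-RiemannHypothesis-0392). The
thesis is typed with the lower Lebesgue integral
`∫⁻ t, ENNReal.ofReal (‖1 - ζ(1/2+it) A(1/2+it)‖² / (1/4+t²))`, `A(s) = Σ_{k<N} a_k (k+1)^{-s}`,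
so that no integrability side condition appears in the statement. This file proves that side
condition once and for all, UNCONDITIONALLY, so that users of the thesis (crux provers working in
`L²(dt/(1/4+t²))`, anyone passing to Bochner integrals or to the distances `d_N`) may switch
between `∫⁻` and `∫` freely:

* `norm_riemannZeta_half_line_le_eight_mul_rpow` — `‖ζ(1/2+it)‖ ≤ 8 (1+|t|)^{1/4}` for every real
  `t`, from Lehman's bound `‖ζ(1/2+it)‖ ≤ 2.53 t^{1/4}` (`t > 1`; Trudgian 2011, Lemma 2.5 and
  footnote 3), which is PROVED in the tree
  (`Literature.NumberTheory.LFunctions.Trudgian2011_lemma_2_5_allT_holds`, packaged for all `t` as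
  `norm_riemannZeta_half_line_le_allT`).
* `nbIntegrand_le_majorant` — pointwise
  `‖1 - ζA‖²/(1/4+t²) ≤ (1 + 8M(1+|t|)^{1/4})²/(1/4+t²)`, `M = Σ ‖a_k‖`.
* `integrable_nbMajorant` — that majorant is integrable (`≍ (1+|t|)^{-3/2}`).
* `integrable_nbIntegrand`, `nb_lintegral_lt_top`, `nb_lintegral_eq_ofReal_integral` — the
  integrand of the thesis is Bochner-integrable for EVERY Dirichlet polynomial, its `∫⁻` is finite
  and equals `ENNReal.ofReal` of the real integral.
* `nbThesis_iff_integral` — `NbThesis` restated with the real integral `∫`.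

(The informal statement appeals to the Hardy–Littlewood second moment `∫₀ᵀ|ζ(1/2+it)|² ~ T log T`
for integrability; the exponent-`1/4` pointwise bound is a cheaper sufficient input, any exponent
`< 1/2` would do.)

References: R. S. Lehman, Proc. LMS (3) 20 (1970) §3; T. S. Trudgian, Math. Comp. 80 (2011),
Lemma 2.5; L. Báez-Duarte, Rend. Lincei (9) 14 (2003), Thm. 1.1.
-/

noncomputable section

open Complex Filter Topology MeasureTheory
open scoped Real ENNReal

namespace Summit.RiemannHypothesis.RiemannHypothesis.Theorems

open Summit.RiemannHypothesis.RiemannHypothesis.Theses.NymanBeurling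
open Literature.NumberTheory.LFunctions

/-- **Unconditional polynomial bound on the critical line, all `t`:**
`‖ζ(1/2+it)‖ ≤ 8 (1+|t|)^{1/4}`. From the tree's all-`t` form of Lehman's bound
`‖ζ(1/2+it)‖ ≤ 2.53 ‖3+it‖^{1/4}` (`norm_riemannZeta_half_line_le_allT` with the discharged fact
`Trudgian2011_lemma_2_5_allT_holds`) and `‖3+it‖ ≤ 3(1+|t|)`, `2.53 · 3^{1/4} ≤ 8`.
[Trudgian2011, Lemma 2.5; Lehman1970, §3] -/
theorem norm_riemannZeta_half_line_le_eight_mul_rpow (t : ℝ) :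
    ‖riemannZeta (1 / 2 + t * I)‖ ≤ 8 * (1 + |t|) ^ (1 / 4 : ℝ) := by
  have h := norm_riemannZeta_half_line_le_allT Trudgian2011_lemma_2_5_allT_holds t
  have ht : 0 ≤ |t| := abs_nonneg t
  have hK : ‖((5 / 2 : ℝ) : ℂ) + (1 / 2 + t * I)‖ ≤ 3 * (1 + |t|) := by
    have e : ((5 / 2 : ℝ) : ℂ) + (1 / 2 + t * I) = ((3 : ℝ) : ℂ) + t * I := by push_cast; ring
    rw [e]
    calc ‖((3 : ℝ) : ℂ) + t * I‖ ≤ ‖((3 : ℝ) : ℂ)‖ + ‖(t : ℂ) * I‖ := norm_add_le _ _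
      _ = 3 + |t| := by simp
      _ ≤ 3 * (1 + |t|) := by linarith
  have hK4 : ‖((5 / 2 : ℝ) : ℂ) + (1 / 2 + t * I)‖ ^ (1 / 4 : ℝ) ≤ 3 * (1 + |t|) ^ (1 / 4 : ℝ) := by
    calc ‖((5 / 2 : ℝ) : ℂ) + (1 / 2 + t * I)‖ ^ (1 / 4 : ℝ) ≤ (3 * (1 + |t|)) ^ (1 / 4 : ℝ) :=
          Real.rpow_le_rpow (norm_nonneg _) hK (by norm_num)
      _ = (3 : ℝ) ^ (1 / 4 : ℝ) * (1 + |t|) ^ (1 / 4 : ℝ) :=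
          Real.mul_rpow (by norm_num) (by positivity)
      _ ≤ 3 * (1 + |t|) ^ (1 / 4 : ℝ) := by
          gcongr
          calc (3 : ℝ) ^ (1 / 4 : ℝ) ≤ (3 : ℝ) ^ (1 : ℝ) :=
                Real.rpow_le_rpow_of_exponent_le (by norm_num) (by norm_num)
            _ = 3 := Real.rpow_one 3
  have h0 : 0 ≤ (1 + |t|) ^ (1 / 4 : ℝ) := by positivity
  calc ‖riemannZeta (1 / 2 + t * I)‖
      ≤ 2.53 * ‖((5 / 2 : ℝ) : ℂ) + (1 / 2 + t * I)‖ ^ (1 / 4 : ℝ) := h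
    _ ≤ 2.53 * (3 * (1 + |t|) ^ (1 / 4 : ℝ)) := by gcongr
    _ ≤ 8 * (1 + |t|) ^ (1 / 4 : ℝ) := by nlinarith

/-- **Pointwise majorant of the thesis integrand.** For every Dirichlet polynomial
`A(s) = Σ_{k<N} a_k (k+1)^{-s}` and every real `t`,
`‖1 - ζ(1/2+it)A(1/2+it)‖²/(1/4+t²) ≤ (1 + 8M(1+|t|)^{1/4})²/(1/4+t²)` with `M = Σ ‖a_k‖`
(`‖A‖ ≤ M` on the line, `Literature.NumberTheory.LFunctions.norm_dirichletPoly_le`, and the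
`ζ`-bound above). [folklore] -/
theorem nbIntegrand_le_majorant {N : ℕ} (a : Fin N → ℂ) (t : ℝ) :
    ‖1 - riemannZeta (1 / 2 + t * I) *
        ∑ n : Fin N, a n * ((n : ℂ) + 1) ^ (-(1 / 2 + t * I))‖ ^ 2 / (1 / 4 + t ^ 2) ≤
      (1 + (8 * ∑ n : Fin N, ‖a n‖) * (1 + |t|) ^ (1 / 4 : ℝ)) ^ 2 / (1 / 4 + t ^ 2) := by
  set M : ℝ := ∑ n : Fin N, ‖a n‖ with hM
  have hM0 : 0 ≤ M := Finset.sum_nonneg fun n _ ↦ norm_nonneg (a n)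
  have hA : ‖∑ n : Fin N, a n * ((n : ℂ) + 1) ^ (-(1 / 2 + t * I))‖ ≤ M := by
    have h := norm_dirichletPoly_le a (s := 1 / 2 + t * I) (by simp)
    rwa [dirichletPoly_apply] at h
  have hζ := norm_riemannZeta_half_line_le_eight_mul_rpow t
  have h0 : 0 ≤ (1 + |t|) ^ (1 / 4 : ℝ) := by positivity
  have h1 : ‖1 - riemannZeta (1 / 2 + t * I) *
      ∑ n : Fin N, a n * ((n : ℂ) + 1) ^ (-(1 / 2 + t * I))‖ ≤
      1 + (8 * M) * (1 + |t|) ^ (1 / 4 : ℝ) := by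
    calc ‖1 - riemannZeta (1 / 2 + t * I) *
          ∑ n : Fin N, a n * ((n : ℂ) + 1) ^ (-(1 / 2 + t * I))‖
        ≤ ‖(1 : ℂ)‖ + ‖riemannZeta (1 / 2 + t * I) *
            ∑ n : Fin N, a n * ((n : ℂ) + 1) ^ (-(1 / 2 + t * I))‖ := norm_sub_le _ _
      _ = 1 + ‖riemannZeta (1 / 2 + t * I)‖ *
            ‖∑ n : Fin N, a n * ((n : ℂ) + 1) ^ (-(1 / 2 + t * I))‖ := by
          rw [norm_one, norm_mul]
      _ ≤ 1 + (8 * (1 + |t|) ^ (1 / 4 : ℝ)) * M := by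
          gcongr
      _ = 1 + (8 * M) * (1 + |t|) ^ (1 / 4 : ℝ) := by ring
  have hq : 0 < 1 / 4 + t ^ 2 := by positivity
  refine div_le_div_of_nonneg_right ?_ hq.le
  exact pow_le_pow_left₀ (norm_nonneg _) h1 2

/-- **The majorant is integrable**: `t ↦ (1 + C(1+|t|)^{1/4})²/(1/4+t²)` is Bochner-integrable on
`ℝ` for every real `C` (it is `≤ 8(2+2C²)(1+|t|)^{-3/2}`, and `(1+‖t‖)^{-r}` is integrable on `ℝ`
for `r > 1`, `integrable_one_add_norm`). The estimate is the one used for the term `T₁` in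
`Literature.NumberTheory.LFunctions.tendsto_lintegral_T1`. [folklore] -/
theorem integrable_nbMajorant (C : ℝ) :
    Integrable fun t : ℝ ↦ (1 + C * (1 + |t|) ^ (1 / 4 : ℝ)) ^ 2 / (1 / 4 + t ^ 2) := by
  have hr : (Module.finrank ℝ ℝ : ℝ) < 3 / 2 := by simp; norm_num
  have h := (integrable_one_add_norm (E := ℝ) (μ := volume) hr).const_mul (8 * (2 + 2 * C ^ 2))
  refine h.mono' ?_ (Eventually.of_forall fun t ↦ ?_)
  · refine Continuous.aestronglyMeasurable ?_
    refine Continuous.div ?_ (by fun_prop) (fun t ↦ by positivity)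
    refine (continuous_const.add (continuous_const.mul ?_)).pow 2
    exact (continuous_const.add continuous_abs).rpow_const fun t ↦ Or.inl (by
      show (1 : ℝ) + |t| ≠ 0
      positivity)
  · have ht : 0 ≤ |t| := abs_nonneg t
    rw [Real.norm_of_nonneg (by positivity)]
    have h1 : (1 + C * (1 + |t|) ^ (1 / 4 : ℝ)) ^ 2 ≤
        (2 + 2 * C ^ 2) * (1 + |t|) ^ (1 / 2 : ℝ) := by
      have hp : ((1 + |t|) ^ (1 / 4 : ℝ)) ^ 2 = (1 + |t|) ^ (1 / 2 : ℝ) := by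
        rw [← Real.rpow_natCast, ← Real.rpow_mul (by positivity)]; norm_num
      have hq : 1 ≤ (1 + |t|) ^ (1 / 2 : ℝ) := Real.one_le_rpow (by linarith) (by norm_num)
      have h0 : 0 ≤ (1 + |t|) ^ (1 / 4 : ℝ) := by positivity
      nlinarith [sq_nonneg (1 - C * (1 + |t|) ^ (1 / 4 : ℝ))]
    have h2 := inv_quarter_add_sq_le t
    have hsplit :
        (1 + |t|) ^ (1 / 2 : ℝ) * (1 + |t|) ^ (-(2 : ℝ)) = (1 + |t|) ^ (-(3 / 2 : ℝ)) := by
      rw [← Real.rpow_add (by positivity)]; norm_num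
    calc (1 + C * (1 + |t|) ^ (1 / 4 : ℝ)) ^ 2 / (1 / 4 + t ^ 2)
        = (1 + C * (1 + |t|) ^ (1 / 4 : ℝ)) ^ 2 * (1 / (1 / 4 + t ^ 2)) := by ring
      _ ≤ ((2 + 2 * C ^ 2) * (1 + |t|) ^ (1 / 2 : ℝ)) * (8 * (1 + |t|) ^ (-(2 : ℝ))) := by
          gcongr
      _ = 8 * (2 + 2 * C ^ 2) * (1 + ‖t‖) ^ (-(3 / 2 : ℝ)) := by
          rw [Real.norm_eq_abs, ← hsplit]; ring

/-- The thesis integrand `t ↦ ‖1 - ζ(1/2+it)A(1/2+it)‖²/(1/4+t²)` is continuous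
(`ζ` is continuous on the critical line, which misses the pole). [folklore] -/
theorem continuous_nbIntegrand {N : ℕ} (a : Fin N → ℂ) :
    Continuous fun t : ℝ ↦ ‖1 - riemannZeta (1 / 2 + t * I) *
        ∑ n : Fin N, a n * ((n : ℂ) + 1) ^ (-(1 / 2 + t * I))‖ ^ 2 / (1 / 4 + t ^ 2) := by
  have hc : Continuous fun t : ℝ ↦ (1 / 2 : ℂ) + t * I := by fun_prop
  have hA : Continuous fun t : ℝ ↦ ∑ n : Fin N, a n * ((n : ℂ) + 1) ^ (-(1 / 2 + t * I)) := by
    have h := (NymanBeurlingDirichlet.continuous_dirichletPoly a).comp hc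
    simpa only [Function.comp_def, dirichletPoly_apply] using h
  refine Continuous.div ((continuous_const.sub (continuous_riemannZeta_line.mul hA)).norm.pow 2)
    (by fun_prop) (fun t ↦ by positivity)

/-- **The thesis integrand is integrable for every Dirichlet polynomial** (unconditionally):
`∫_ℝ ‖1 - ζ(1/2+it)A(1/2+it)‖²/(1/4+t²) dt < ∞`. [folklore] -/
theorem integrable_nbIntegrand {N : ℕ} (a : Fin N → ℂ) :
    Integrable fun t : ℝ ↦ ‖1 - riemannZeta (1 / 2 + t * I) *
        ∑ n : Fin N, a n * ((n : ℂ) + 1) ^ (-(1 / 2 + t * I))‖ ^ 2 / (1 / 4 + t ^ 2) := by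
  refine (integrable_nbMajorant (8 * ∑ n : Fin N, ‖a n‖)).mono'
    (continuous_nbIntegrand a).aestronglyMeasurable (Eventually.of_forall fun t ↦ ?_)
  rw [Real.norm_of_nonneg (by positivity)]
  exact nbIntegrand_le_majorant a t

/-- **The distance integral of the thesis is finite** for every `N` and every coefficient vector:
`∫⁻ ‖1 - ζA‖²/(1/4+t²) < ⊤`. [folklore] -/
theorem nb_lintegral_lt_top {N : ℕ} (a : Fin N → ℂ) :
    ∫⁻ t : ℝ, ENNReal.ofReal (‖1 - riemannZeta (1 / 2 + t * I) *
        ∑ n : Fin N, a n * ((n : ℂ) + 1) ^ (-(1 / 2 + t * I))‖ ^ 2 / (1 / 4 + t ^ 2)) < ⊤ :=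
  (integrable_nbIntegrand a).lintegral_lt_top

/-- The `∫⁻` of the thesis equals `ENNReal.ofReal` of the Bochner integral of the same
(nonnegative, integrable) integrand. [folklore] -/
theorem nb_lintegral_eq_ofReal_integral {N : ℕ} (a : Fin N → ℂ) :
    ∫⁻ t : ℝ, ENNReal.ofReal (‖1 - riemannZeta (1 / 2 + t * I) *
        ∑ n : Fin N, a n * ((n : ℂ) + 1) ^ (-(1 / 2 + t * I))‖ ^ 2 / (1 / 4 + t ^ 2)) =
      ENNReal.ofReal (∫ t : ℝ, ‖1 - riemannZeta (1 / 2 + t * I) *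
        ∑ n : Fin N, a n * ((n : ℂ) + 1) ^ (-(1 / 2 + t * I))‖ ^ 2 / (1 / 4 + t ^ 2)) :=
  (ofReal_integral_eq_lintegral_ofReal (integrable_nbIntegrand a)
    (Eventually.of_forall fun t ↦ by positivity)).symm

/-- **`NbThesis` with real integrals.** The thesis is equivalent to its Bochner-integral form:
for every `ε > 0` some Dirichlet polynomial has `∫_ℝ ‖1 - ζ(1/2+it)A(1/2+it)‖²/(1/4+t²) dt < ε`
(the integrand being integrable for every `A`, `integrable_nbIntegrand`). [folklore] -/
theorem nbThesis_iff_integral :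
    NbThesis ↔ ∀ ε : ℝ, 0 < ε → ∃ (N : ℕ) (a : Fin N → ℂ),
      ∫ t : ℝ, ‖1 - riemannZeta (1 / 2 + t * I) *
        ∑ n : Fin N, a n * ((n : ℂ) + 1) ^ (-(1 / 2 + t * I))‖ ^ 2 / (1 / 4 + t ^ 2) < ε := by
  unfold NbThesis
  refine forall₂_congr fun ε hε ↦ exists_congr fun N ↦ exists_congr fun a ↦ ?_
  rw [nb_lintegral_eq_ofReal_integral a, ENNReal.ofReal_lt_ofReal_iff hε]

end Summit.RiemannHypothesis.RiemannHypothesis.Theorems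

end

/-!
## Appendix (appended 2026-08-15): the thesis as `d_N → 0`

In print the Báez-Duarte criterion is stated through the distances
`d_N² = inf_{A_N} (1/2π) ∫_ℝ |1 - ζA_N(1/2+it)|² dt/(1/4+t²)` as "RH iff `lim_{N→∞} d_N = 0`"
(Bettin–Conrey–Farmer 2013, §1; Báez-Duarte 2003, Thm. 1.1), whereas the Lean thesis is the
`ε`-form "for every `ε > 0` some Dirichlet polynomial has integral `< ε`". The appendix proves the
two readings agree, with the distance functional written inline as
`D N = ⨅ a : Fin N → ℂ, ∫ ‖1 - ζ(1/2+it) Σ_{k<N} a_k (k+1)^{-(1/2+it)}‖²/(1/4+t²) dt`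
(`= 2π d_N²`; no new definition is introduced):

* `nb_integral_nonneg`, `nb_bddBelow_range`, `nb_dist_nonneg` — `0 ≤ ∫ …`, `0 ≤ D N`;
* `nb_dirichletSum_extend` — zero-padding the coefficient vector from `Fin N` to `Fin N'`
  (`N ≤ N'`) leaves the Dirichlet polynomial unchanged; `nb_dist_antitone` — so `D` is
  non-increasing in `N`;
* `integral_inv_quarter_add_sq`, `nb_integral_zero_coeff`, `nb_dist_le_two_pi`, `nb_dist_zero` —
  the zero polynomial: `∫ dt/(1/4+t²) = 2π`, so `D N ≤ 2π` and `D 0 = 2π` (`d_0 = ‖χ‖ = 1`);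
* `nbThesis_iff_tendsto` — `NbThesis ↔ D N → 0` (`N → ∞`), through `nbThesis_iff_integral`.
-/

noncomputable section

open Complex Filter Topology MeasureTheory
open scoped Real ENNReal

namespace Summit.RiemannHypothesis.RiemannHypothesis.Theorems

open Summit.RiemannHypothesis.RiemannHypothesis.Theses.NymanBeurling
open Literature.NumberTheory.LFunctions

/-- The real distance integral of the thesis is nonnegative. [folklore] -/
theorem nb_integral_nonneg {N : ℕ} (a : Fin N → ℂ) :
    0 ≤ ∫ t : ℝ, ‖1 - riemannZeta (1 / 2 + t * I) *
        ∑ n : Fin N, a n * ((n : ℂ) + 1) ^ (-(1 / 2 + t * I))‖ ^ 2 / (1 / 4 + t ^ 2) :=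
  integral_nonneg fun t ↦ by positivity

/-- The set of distance integrals over all coefficient vectors of length `N` is bounded below
(by `0`). [folklore] -/
theorem nb_bddBelow_range (N : ℕ) :
    BddBelow (Set.range fun a : Fin N → ℂ ↦ ∫ t : ℝ, ‖1 - riemannZeta (1 / 2 + t * I) *
        ∑ n : Fin N, a n * ((n : ℂ) + 1) ^ (-(1 / 2 + t * I))‖ ^ 2 / (1 / 4 + t ^ 2)) := by
  refine ⟨0, ?_⟩
  rintro _ ⟨a, rfl⟩
  exact nb_integral_nonneg a

/-- `0 ≤ D N`: the infimum of the distance integrals over all length-`N` coefficient vectors is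
nonnegative. [folklore] -/
theorem nb_dist_nonneg (N : ℕ) :
    0 ≤ ⨅ a : Fin N → ℂ, ∫ t : ℝ, ‖1 - riemannZeta (1 / 2 + t * I) *
        ∑ n : Fin N, a n * ((n : ℂ) + 1) ^ (-(1 / 2 + t * I))‖ ^ 2 / (1 / 4 + t ^ 2) :=
  le_ciInf fun a ↦ nb_integral_nonneg a

/-- **Zero-padding.** For `N ≤ N'`, extending `a : Fin N → ℂ` by zeros to `Fin N'` does not change
the Dirichlet polynomial `Σ a_k (k+1)^{-s}`. [folklore] -/
theorem nb_dirichletSum_extend {N N' : ℕ} (h : N ≤ N') (a : Fin N → ℂ) (s : ℂ) :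
    ∑ n : Fin N', (if hn : (n : ℕ) < N then a ⟨n, hn⟩ else 0) * ((n : ℂ) + 1) ^ (-s) =
      ∑ n : Fin N, a n * ((n : ℂ) + 1) ^ (-s) := by
  have h1 : ∑ n : Fin N', (if hn : (n : ℕ) < N then a ⟨n, hn⟩ else 0) * ((n : ℂ) + 1) ^ (-s) =
      ∑ k ∈ Finset.range N', (if hk : k < N then a ⟨k, hk⟩ else 0) * ((k : ℂ) + 1) ^ (-s) :=
    Fin.sum_univ_eq_sum_range (fun k ↦ (if hk : k < N then a ⟨k, hk⟩ else 0) *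
      ((k : ℂ) + 1) ^ (-s)) N'
  have h2 : ∑ n : Fin N, a n * ((n : ℂ) + 1) ^ (-s) =
      ∑ k ∈ Finset.range N, (if hk : k < N then a ⟨k, hk⟩ else 0) * ((k : ℂ) + 1) ^ (-s) := by
    rw [← Fin.sum_univ_eq_sum_range (fun k ↦ (if hk : k < N then a ⟨k, hk⟩ else 0) *
      ((k : ℂ) + 1) ^ (-s)) N]
    refine Finset.sum_congr rfl fun n _ ↦ ?_
    rw [dif_pos n.isLt]
  rw [h1, h2]
  symm
  refine Finset.sum_subset (Finset.range_subset_range.mpr h) fun k _ hk ↦ ?_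
  have hk' : ¬ k < N := by simpa using hk
  rw [dif_neg hk', zero_mul]

/-- **`D` is non-increasing in `N`**: a longer Dirichlet polynomial approximates at least as well
(pad the coefficients with zeros). [folklore] -/
theorem nb_dist_antitone :
    Antitone fun N : ℕ ↦ ⨅ a : Fin N → ℂ, ∫ t : ℝ, ‖1 - riemannZeta (1 / 2 + t * I) *
        ∑ n : Fin N, a n * ((n : ℂ) + 1) ^ (-(1 / 2 + t * I))‖ ^ 2 / (1 / 4 + t ^ 2) := by
  intro N N' h
  refine le_ciInf fun a ↦ ?_
  refine (ciInf_le (nb_bddBelow_range N')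
    (fun n : Fin N' ↦ if hn : (n : ℕ) < N then a ⟨n, hn⟩ else 0)).trans_eq ?_
  refine integral_congr_ae (Eventually.of_forall fun t ↦ ?_)
  simp only [nb_dirichletSum_extend h a]

/-- `∫_ℝ dt/(1/4+t²) = 2π` (substitute `u = 2t` in `∫ (1+u²)⁻¹ = π`). [folklore] -/
theorem integral_inv_quarter_add_sq : ∫ t : ℝ, 1 / (1 / 4 + t ^ 2) = 2 * π := by
  have h : ∀ t : ℝ, 1 / (1 / 4 + t ^ 2) = 4 * (1 + (2 * t) ^ 2)⁻¹ := by
    intro t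
    have ht : (0 : ℝ) < 1 / 4 + t ^ 2 := by positivity
    field_simp
    ring
  simp_rw [h, integral_const_mul]
  rw [Measure.integral_comp_mul_left (fun u : ℝ ↦ (1 + u ^ 2)⁻¹) 2, integral_univ_inv_one_add_sq,
    smul_eq_mul, abs_of_pos (by norm_num : (0 : ℝ) < 2⁻¹)]
  ring

/-- **The trivial polynomial.** With all coefficients `0` the thesis integrand is `1/(1/4+t²)` and
the distance integral equals `2π` (`= 2π‖χ_(0,1)‖²`, consistent with the Mellin normalisation
`∫ = 2π d_N²`, `d_0 = 1`). [folklore] -/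
theorem nb_integral_zero_coeff (N : ℕ) :
    ∫ t : ℝ, ‖1 - riemannZeta (1 / 2 + t * I) *
        ∑ n : Fin N, (0 : Fin N → ℂ) n * ((n : ℂ) + 1) ^ (-(1 / 2 + t * I))‖ ^ 2 / (1 / 4 + t ^ 2) =
      2 * π := by
  have h : ∀ t : ℝ, ‖1 - riemannZeta (1 / 2 + t * I) *
      ∑ n : Fin N, (0 : Fin N → ℂ) n * ((n : ℂ) + 1) ^ (-(1 / 2 + t * I))‖ ^ 2 / (1 / 4 + t ^ 2) =
      1 / (1 / 4 + t ^ 2) := by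
    intro t
    simp
  simp_rw [h]
  exact integral_inv_quarter_add_sq

/-- `D N ≤ 2π` for every `N` (test the zero polynomial). In particular `NbRateLog`-type bounds
`C/log N` are only informative for `C/log N < 2π`. [folklore] -/
theorem nb_dist_le_two_pi (N : ℕ) :
    (⨅ a : Fin N → ℂ, ∫ t : ℝ, ‖1 - riemannZeta (1 / 2 + t * I) *
        ∑ n : Fin N, a n * ((n : ℂ) + 1) ^ (-(1 / 2 + t * I))‖ ^ 2 / (1 / 4 + t ^ 2)) ≤ 2 * π :=
  (ciInf_le (nb_bddBelow_range N) 0).trans_eq (nb_integral_zero_coeff N)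

/-- `D 0 = 2π`: with no terms the only Dirichlet polynomial is `0`. (So the thesis is not
vacuous: for `ε ≤ 2π` some `N ≥ 1` is needed.) [folklore] -/
theorem nb_dist_zero :
    (⨅ a : Fin 0 → ℂ, ∫ t : ℝ, ‖1 - riemannZeta (1 / 2 + t * I) *
        ∑ n : Fin 0, a n * ((n : ℂ) + 1) ^ (-(1 / 2 + t * I))‖ ^ 2 / (1 / 4 + t ^ 2)) = 2 * π := by
  have hr : Set.range (fun a : Fin 0 → ℂ ↦ ∫ t : ℝ, ‖1 - riemannZeta (1 / 2 + t * I) *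
      ∑ n : Fin 0, a n * ((n : ℂ) + 1) ^ (-(1 / 2 + t * I))‖ ^ 2 / (1 / 4 + t ^ 2)) = {2 * π} := by
    ext x
    simp only [Set.mem_range, Set.mem_singleton_iff]
    constructor
    · rintro ⟨a, rfl⟩
      rw [Subsingleton.elim a 0]
      exact nb_integral_zero_coeff 0
    · rintro rfl
      exact ⟨0, nb_integral_zero_coeff 0⟩
  rw [iInf, hr, csInf_singleton]

/-- **The thesis as `d_N → 0`.** `NbThesis` holds iff the infimum `D N` of the distance integrals
over all length-`N` Dirichlet polynomials tends to `0` as `N → ∞` (`D N = 2π d_N²` in the notation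
of Báez-Duarte / Bettin–Conrey–Farmer). Uses `nbThesis_iff_integral`, `0 ≤ D`, and that `D` is
non-increasing. [BaezDuarte2003, Thm. 1.1 (statement via `d_N`); BettinConreyFarmer2013, §1] -/
theorem nbThesis_iff_tendsto :
    NbThesis ↔ Tendsto (fun N : ℕ ↦ ⨅ a : Fin N → ℂ, ∫ t : ℝ, ‖1 - riemannZeta (1 / 2 + t * I) *
        ∑ n : Fin N, a n * ((n : ℂ) + 1) ^ (-(1 / 2 + t * I))‖ ^ 2 / (1 / 4 + t ^ 2))
      atTop (𝓝 0) := by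
  rw [nbThesis_iff_integral, Metric.tendsto_atTop]
  have hanti := nb_dist_antitone
  constructor
  · intro h ε hε
    obtain ⟨N, a, ha⟩ := h ε hε
    refine ⟨N, fun n hn ↦ ?_⟩
    rw [Real.dist_eq, sub_zero, abs_of_nonneg (nb_dist_nonneg n)]
    exact ((hanti hn).trans (ciInf_le (nb_bddBelow_range N) a)).trans_lt ha
  · intro h ε hε
    obtain ⟨N, hN⟩ := h ε hε
    have hlt := hN N le_rfl
    rw [Real.dist_eq, sub_zero, abs_of_nonneg (nb_dist_nonneg N)] at hlt
    obtain ⟨a, ha⟩ := (ciInf_lt_iff (nb_bddBelow_range N)).mp hlt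
    exact ⟨N, a, ha⟩

end Summit.RiemannHypothesis.RiemannHypothesis.Theorems

end
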